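import Literature.NumberTheory.EllipticCurves.SelmerGroupOverBaseChangeModel
import Literature.NumberTheory.EllipticCurves.SubgroupSelmerProofs
import Summits.BirchSwinnertonDyer.Rank1Residual.Additive.LocalSubgroupTransport
import Summits.BirchSwinnertonDyer.Rank1Residual.Additive.EmbeddingPlaceFactorisation
import Summits.BirchSwinnertonDyer.Rank1Residual.Additive.InfiniteCompletionGaloisConj
import HarnessLib

/-!
# Route ByReductionTypeAtTwo, crux `AdditivePotMultOverKAtTwo` (stmt-BirchSwinnertonDyer-22618) — Selmer base change
# along a finite Galois `L/K` at an infinite level, I: the subgroup model `subgroupModelIso` CARRIES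
# `Sel_{p^∞}(E_L/L̄^{H′})` INTO `Sel_{p^∞}(E/K̄^{galImage H′})`

Cell `bsd-2adic`, seat `bsd-2adic-t42` GEN 24 (Stage B of memo `t42/DESIGN-T42-ADDENDUM-27.md` §A27.3, the model
identification `ΘS` displayed by `Theorems/ByReductionTypeAtTwoAdditiveKatoTransportQuadraticLayer`). HONEST FRAMING
(D-0036 / D-0054): theorems only (Galois-cohomology bookkeeping); types-the-object-of; closes none; nothing booked; BSD is
not proved by any of this. PARTITION: X5@2 additive, C4″ 22618 (−1)/(−2)-split-twist blocks × `p = 2` (the consumer), but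
everything here is for ANY number fields `K ⊆ L` (`L/K` Galois), ANY `W/K`, ANY `p`, ANY closed `H′ ≤ Γ_L`.

Setting. `Literature/…/SelmerGroupOverBaseChangeModel` (p701196) identifies `H¹(H′, E_L[p^∞])` (`H′ ≤ Γ_L`) with
`H¹(galImage H′, E[p^∞])` (`galImage H′ = resGal(H′) ≤ Γ_K`) by `subgroupModelIso`, `conj`-equivariantly, and shows that the
LOCAL Selmer conditions at a common `L`-field correspond. The two SELMER groups
`(W.baseChange L).selmerGroupOver p H′` (conditions at the places of `L`, all `Γ_L`-conjugates) and
`W.selmerGroupOver p (galImage H′)` (conditions at the places of `K`, all `Γ_K`-conjugates) are subgroups of these; this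
file proves `Θ(Sel^L_{H′}) ⊆ Sel^K_{galImage H′}` — the transport of cell `b2b-bsdres`'s files C/D/F
(`Additive/LocalSubgroupTransport`, `…/ZpTowerSelmerTransport`, `…/ZpTowerSelmerInfty`, written for a LAYER `L = K_n` and
`kerH1Iso`) re-run for a general finite Galois `L/K` and p701196's `subgroupModelIso`:

* §1 `subgroupModelIso_mem_localKerOverOfEmb_of_factorisation` — the generic local step: for a `K`-field `E`, an
  `L`-field `E′`, `f : E → E′`, a `K`-embedding `ι : K̄ → Ē` and `ε : E′ → Ē` with `ε ∘ f = (E → Ē)`,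
  `ε|_L = ι ∘ j_L` (`j_L = embIntoClosure`) and `E′ = ⟨f(E), L⟩`: if all `Γ_L`-conjugates of `x` satisfy the local
  condition at `E′`, then `subgroupModelIso x` satisfies the local condition at `ι`. KEY POINT (why no corestriction /
  no factor `2` appears): `galImage H′ ≤ galRange L`, so every `h ∈ Γ_E` restricting into `galImage H′` fixes
  `ε(E′) = ⟨E, ε(L)⟩` (file C's `hfix`).
* §2 finite places (`exists_place_factorisation`), §3 infinite places (`exists_infinitePlace_factorisation`), in the
  `∀ ι` and in the `conj_σ` forms.
* §4 **`subgroupModelIso_mem_selmerGroupOver`**: `x ∈ Sel^L_{H′} → subgroupModelIso x ∈ Sel^K_{galImage H′}`.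

The reverse inclusion and the packaged isomorphism of Selmer groups are in the sequel
`…AdditiveSelmerBaseChangeModelIso`.

References: [SerreGaloisCohomology1997] I.§2.4–2.5, II.§1.1; [GreenbergLNM1716] §2 (the local condition at every prime of
`M = K̄^H` above `v` = all `Γ_K`-conjugates of one decomposition group); [NeukirchANT1999] II.§8 (`Hom_K(L, Ω) = ∐_{w∣v}
Hom_{K_v}(L_w, Ω)`); [Mazur1972] §6.
-/

set_option autoImplicit false
-- the summit's namespace `Summit.BirchSwinnertonDyer.BirchSwinnertonDyer` (Sub = Summit) trips `dupNamespace`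
set_option linter.dupNamespace false

noncomputable section

open scoped Classical NumberField.LiesOver

open NumberField IsDedekindDomain Literature.NumberTheory.EllipticCurves
  Literature.NumberTheory.EllipticCurves.BaseChangeModel
  Summit.BirchSwinnertonDyer.Rank1Residual.Additive.LocalTransport

universe u

namespace Summit.BirchSwinnertonDyer.BirchSwinnertonDyer.Theorems.SelmerBaseChange

variable {K : Type u} [Field K] [NumberField K] (L : Type u) [Field L] [NumberField L] [Algebra K L]
  (H' : Subgroup (Field.absoluteGaloisGroup L)) [H'.Normal] (W : WeierstrassCurve K) (p : ℕ)

/-! ## §1 The generic local step -/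

section Generic

variable {E : Type u} [Field E] [Algebra K E]
variable {E' : Type u} [Field E'] [Algebra K E'] [Algebra L E'] [IsScalarTower K L E']

/-- **Generic local step** (cell `b2b-bsdres` file D, for a general finite `L/K` and p701196's `subgroupModelIso`). For a
`K`-field `E`, an `L`-field `E′`, `f : E → E′`, a `K`-embedding `ι : K̄ → Ē` and `ε : E′ → Ē` with `ε ∘ f = (E → Ē)`,
`ε|_L = ι ∘ j_L` and `E′` generated by `f(E) ∪ L`: if every `Γ_L`-conjugate of `x ∈ H¹(H′, E_L[p^∞])` dies at `E′`, then
`subgroupModelIso x ∈ H¹(galImage H′, E[p^∞])` dies at `ι`. The elements of `Γ_E` restricting into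
`galImage H′ ≤ galRange L` fix `ε(E′)` (no corestriction is needed). [cite: SerreGaloisCohomology1997, II.§1.1]
[cite: GreenbergLNM1716, §2] -/
theorem subgroupModelIso_mem_localKerOverOfEmb_of_factorisation
    (ι : AlgebraicClosure K →ₐ[K] AlgebraicClosure E) (f : E →+* E')
    (ε : E' →+* AlgebraicClosure E) (hεf : ε.comp f = algebraMap E (AlgebraicClosure E))
    (hεL : ∀ l : L, ε (algebraMap L E' l) =
      ι ((algEquivOfEmb L (closureEmb (K := K) L)).symm (algebraMap L (AlgebraicClosure L) l)))
    (hgen : Subring.closure (Set.range f ∪ Set.range (algebraMap L E')) = ⊤)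
    (x : (W.baseChange L).subgroupH1 p H')
    (hx : ∀ σ : Field.absoluteGaloisGroup L,
      (W.baseChange L).conjH1 p H' σ x ∈ (W.baseChange L).localKerOver p H' E') :
    subgroupModelIso K L H' W p x ∈ W.localKerOverOfEmb p (galImage K L H') ι := by
  let ιL : AlgebraicClosure K ≃ₐ[K] AlgebraicClosure L := algEquivOfEmb L (closureEmb (K := K) L)
  -- (1) `Ē` is an algebraic `E'`-algebra through `ε`
  letI : Algebra E' (AlgebraicClosure E) := ε.toAlgebra
  letI : Algebra E E' := f.toAlgebra
  haveI : IsScalarTower E E' (AlgebraicClosure E) :=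
    IsScalarTower.of_algebraMap_eq fun a ↦ (RingHom.congr_fun hεf a).symm
  haveI : Algebra.IsAlgebraic E' (AlgebraicClosure E) := Algebra.IsAlgebraic.tower_top (K := E) E'
  -- (2) `ι₂ : Ē ≃ Ē'` over `E'`
  let ι₂₀ : AlgebraicClosure E →ₐ[E'] AlgebraicClosure E' := IsAlgClosed.lift
  have hι₂bij : Function.Bijective ι₂₀ := by
    letI : Algebra (AlgebraicClosure E) (AlgebraicClosure E') := ι₂₀.toRingHom.toAlgebra
    haveI : IsScalarTower E' (AlgebraicClosure E) (AlgebraicClosure E') :=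
      IsScalarTower.of_algebraMap_eq fun y ↦ (ι₂₀.commutes y).symm
    haveI : Algebra.IsAlgebraic (AlgebraicClosure E) (AlgebraicClosure E') :=
      Algebra.IsAlgebraic.tower_top (K := E') (AlgebraicClosure E)
    exact IsAlgClosed.algebraMap_bijective_of_isIntegral (k := AlgebraicClosure E) (K := AlgebraicClosure E')
  let ι₂ : AlgebraicClosure E ≃+* AlgebraicClosure E' := RingEquiv.ofBijective ι₂₀.toRingHom hι₂bij
  have hι₂ε : ∀ y : E', ι₂ (ε y) = algebraMap E' (AlgebraicClosure E') y := fun y ↦ ι₂₀.commutes y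
  have hι₂symm : ∀ y : E', ι₂.symm (algebraMap E' (AlgebraicClosure E') y) = ε y := fun y ↦ by
    rw [← hι₂ε, RingEquiv.symm_apply_apply]
  -- (3) `ι' : L̄ → Ē'` over `L`, with `ι' ∘ ι_L = ι₂ ∘ ι`
  have hι'L : ∀ l : L,
      ι₂ (ι (ιL.symm (algebraMap L (AlgebraicClosure L) l))) = algebraMap L (AlgebraicClosure E') l := fun l ↦ by
    rw [← hεL l, hι₂ε, ← IsScalarTower.algebraMap_apply]
  let ι' : AlgebraicClosure L →ₐ[L] AlgebraicClosure E' :=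
    { ι₂.toRingHom.comp (ι.toRingHom.comp (ιL.symm : AlgebraicClosure L →+* AlgebraicClosure K)) with
      commutes' := fun l ↦ hι'L l }
  have hι'apply : ∀ z', ι' z' = ι₂ (ι (ιL.symm z')) := fun _ ↦ rfl
  have hcompat : ∀ z, ι' (closureEmb (K := K) L z) = ι₂ (ι z) := fun z ↦ by
    rw [hι'apply, ← algEquivOfEmb_apply L (closureEmb (K := K) L) z, AlgEquiv.symm_apply_apply]
  -- (4) the elements of `Γ_E` restricting into `galImage H' ≤ galRange L` fix `ι₂⁻¹(E') = ε(E')`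
  have hfix : ∀ h : Field.absoluteGaloisGroup E, resGalOfEmb ι h ∈ galImage K L H' → ∀ y : E',
      (show AlgebraicClosure E ≃ₐ[E] AlgebraicClosure E from h)
        (ι₂.symm (algebraMap E' (AlgebraicClosure E') y)) =
          ι₂.symm (algebraMap E' (AlgebraicClosure E') y) := by
    intro h hh y
    obtain ⟨σ', hσ'⟩ : resGalOfEmb ι h ∈ galRange (K := K) L := galImage_le_galRange K L H' hh
    rw [hι₂symm]
    have hσ : resGal (K := K) L σ' = resGalOfEmb ι h := hσ'
    have key : (((show AlgebraicClosure E ≃ₐ[E] AlgebraicClosure E from h) :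
        AlgebraicClosure E →+* AlgebraicClosure E).comp ε) = ε := by
      refine RingHom.eq_of_eqOn_set_dense hgen ?_
      rintro _ (⟨a, rfl⟩ | ⟨l, rfl⟩)
      · have hfa : ε (f a) = algebraMap E (AlgebraicClosure E) a := RingHom.congr_fun hεf a
        change (show AlgebraicClosure E ≃ₐ[E] AlgebraicClosure E from h) (ε (f a)) = ε (f a)
        rw [hfa]
        exact AlgEquiv.commutes _ a
      · have hz : (show AlgebraicClosure K ≃ₐ[K] AlgebraicClosure K from resGalOfEmb ι h)
            (ιL.symm (algebraMap L (AlgebraicClosure L) l)) = ιL.symm (algebraMap L (AlgebraicClosure L) l) := by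
          apply ιL.injective
          rw [← hσ]
          have e := algEquivOfEmb_resGal_apply L σ' (ιL.symm (algebraMap L (AlgebraicClosure L) l))
          refine e.trans ?_
          change (show AlgebraicClosure L ≃ₐ[L] AlgebraicClosure L from σ') (ιL (ιL.symm _)) = ιL (ιL.symm _)
          rw [AlgEquiv.apply_symm_apply, AlgEquiv.commutes]
        change (show AlgebraicClosure E ≃ₐ[E] AlgebraicClosure E from h) (ε (algebraMap L E' l)) =
          ε (algebraMap L E' l)
        rw [hεL l]
        exact (apply_resGalAuxOfEmb_apply ι h _).symm.trans (congrArg ι hz)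
    exact RingHom.congr_fun key y
  -- (5) the `L`-side local condition at `ι'`, and the transfer
  have hx' : (W.baseChange L).localResOverOfEmb p H' ι' x = 0 := by
    obtain ⟨τ, hτ⟩ := (W.baseChange L).exists_localKerOverOfEmb_eq_comap_holds p H' ι'
    have hmem : x ∈ (W.baseChange L).localKerOverOfEmb p H' ι' := by
      rw [hτ]; exact hx τ
    exact hmem
  have h0 := localResOverOfEmb_resH1Hom_eq_zero L (galImage K L H') H'
    (fun τ hτ ↦ (resGal_mem_galImage_iff K L H' τ).mp hτ) ι ι₂ ι' hcompat hfix W p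
    (ofGalImage K L H') (resGal_ofGalImage K L H')
    (fun τ Q ↦ primaryBaseChangeEquiv_symm_smul_ofGalImage K L H' W p τ Q) x hx'
  rw [WeierstrassCurve.localKerOverOfEmb, AddMonoidHom.mem_ker, subgroupModelIso_apply]
  exact h0

end Generic

/-! ## §2 Finite places -/

section Finite

variable [IsGalois K L]

omit [NumberField K] [NumberField L] [H'.Normal] in
/-- The ring homomorphism `φ = ι ∘ j_L : L → Ē`, `j_L = ι_L⁻¹ ∘ (L → L̄)`, and its restriction to `K`.
[cite: SerreGaloisCohomology1997, II.§1.1] -/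
private theorem comp_embIntoClosure_comp_algebraMap {E : Type u} [Field E] [Algebra K E]
    (ι : AlgebraicClosure K →ₐ[K] AlgebraicClosure E) :
    (ι.toRingHom.comp (((algEquivOfEmb L (closureEmb (K := K) L)).symm :
        AlgebraicClosure L →+* AlgebraicClosure K).comp (algebraMap L (AlgebraicClosure L)))).comp (algebraMap K L) =
      (algebraMap E (AlgebraicClosure E)).comp (algebraMap K E) := by
  ext x
  change ι ((algEquivOfEmb L (closureEmb (K := K) L)).symm (algebraMap L (AlgebraicClosure L) (algebraMap K L x))) =
    algebraMap E _ (algebraMap K E x)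
  rw [← IsScalarTower.algebraMap_apply K L (AlgebraicClosure L), AlgEquiv.commutes, AlgHom.commutes,
    ← IsScalarTower.algebraMap_apply]

/-- **Finite places.** For `x ∈ Sel_{p^∞}(E_L/L̄^{H′})` (conditions at the places of `L`), every finite place `v` of
`K` and EVERY `K`-embedding `ι : K̄ → K̄_v`, `subgroupModelIso x` dies in `H¹((res_ι)⁻¹(galImage H′), E(K̄_v))`: the
`K`-embedding `ι ∘ j_L` factors through some `L_w`, `w ∣ v` (`exists_place_factorisation`), and §1 applies with
`E′ = L_w = ⟨K_v, L⟩`. [cite: GreenbergLNM1716, §2] [cite: NeukirchANT1999, II.§8] -/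
theorem subgroupModelIso_mem_localKerOverOfEmb_adicCompletion (v : HeightOneSpectrum (𝓞 K))
    (ι : AlgebraicClosure K →ₐ[K] AlgebraicClosure (v.adicCompletion K))
    (x : (W.baseChange L).subgroupH1 p H') (hx : x ∈ (W.baseChange L).selmerGroupOver p H') :
    subgroupModelIso K L H' W p x ∈ W.localKerOverOfEmb p (galImage K L H') ι := by
  let ιL : AlgebraicClosure K ≃ₐ[K] AlgebraicClosure L := algEquivOfEmb L (closureEmb (K := K) L)
  let φ : L →+* AlgebraicClosure (v.adicCompletion K) :=
    ι.toRingHom.comp ((ιL.symm : AlgebraicClosure L →+* AlgebraicClosure K).comp (algebraMap L (AlgebraicClosure L)))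
  have hφapply : ∀ l, φ l = ι (ιL.symm (algebraMap L (AlgebraicClosure L) l)) := fun _ ↦ rfl
  obtain ⟨w, hw, ε, hεf, hεφ⟩ := exists_place_factorisation L v
    (algebraMap (v.adicCompletion K) (AlgebraicClosure (v.adicCompletion K))) φ
    (comp_embIntoClosure_comp_algebraMap L ι)
  exact subgroupModelIso_mem_localKerOverOfEmb_of_factorisation L H' W p ι (adicCompletionMap (K := K) L v w) ε hεf
    (fun l ↦ (RingHom.congr_fun hεφ l).trans (hφapply l)) (closure_range_adicCompletionMap_union_eq_top L v w) x
    (fun σ ↦ (((W.baseChange L).mem_selmerGroupOver_iff p H' x).1 hx).1 w σ)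

/-- The same in the `conj_σ` form of `mem_selmerGroupOver_iff` (`localKerOverOfEmb_comp`): for every finite place
`v` of `K` and every `σ ∈ Γ_K`, `conj_σ (subgroupModelIso x)` dies at the chosen place above `v`.
[cite: GreenbergLNM1716, §2] -/
theorem conjH1_subgroupModelIso_mem_localKerOver_adicCompletion [(galImage K L H').Normal]
    (v : HeightOneSpectrum (𝓞 K)) (σ : Field.absoluteGaloisGroup K)
    (x : (W.baseChange L).subgroupH1 p H') (hx : x ∈ (W.baseChange L).selmerGroupOver p H') :
    W.conjH1 p (galImage K L H') σ (subgroupModelIso K L H' W p x) ∈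
      W.localKerOver p (galImage K L H') (v.adicCompletion K) := by
  have h := subgroupModelIso_mem_localKerOverOfEmb_adicCompletion L H' W p v
    ((closureEmb (K := K) (v.adicCompletion K)).comp
      ((show AlgebraicClosure K ≃ₐ[K] AlgebraicClosure K from σ) : AlgebraicClosure K →ₐ[K] AlgebraicClosure K)) x hx
  rw [W.localKerOverOfEmb_comp p (galImage K L H'), AddSubgroup.mem_comap] at h
  rw [WeierstrassCurve.localKerOver_eq_ofEmb]
  exact h

end Finite

/-! ## §3 Infinite places -/

section Infinite

variable [IsGalois K L]

/-- **Infinite places.** For `x ∈ Sel_{p^∞}(E_L/L̄^{H′})`, every infinite place `v` of `K` and EVERY `K`-embedding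
`ι : K̄ → K̄_v`, `subgroupModelIso x` dies in `H¹((res_ι)⁻¹(galImage H′), E(K̄_v))`: §1 with `E′ = L_w`, `w ∣ v` from
`exists_infinitePlace_factorisation`. [cite: GreenbergLNM1716, §2] [cite: NeukirchANT1999, II.§8] -/
theorem subgroupModelIso_mem_localKerOverOfEmb_infinitePlace (v : InfinitePlace K)
    (ι : AlgebraicClosure K →ₐ[K] AlgebraicClosure v.Completion)
    (x : (W.baseChange L).subgroupH1 p H') (hx : x ∈ (W.baseChange L).selmerGroupOver p H') :
    subgroupModelIso K L H' W p x ∈ W.localKerOverOfEmb p (galImage K L H') ι := by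
  let ιL : AlgebraicClosure K ≃ₐ[K] AlgebraicClosure L := algEquivOfEmb L (closureEmb (K := K) L)
  let φ : L →+* AlgebraicClosure v.Completion :=
    ι.toRingHom.comp ((ιL.symm : AlgebraicClosure L →+* AlgebraicClosure K).comp (algebraMap L (AlgebraicClosure L)))
  have hφapply : ∀ l, φ l = ι (ιL.symm (algebraMap L (AlgebraicClosure L) l)) := fun _ ↦ rfl
  obtain ⟨w, hw, ε, hεf, hεφ⟩ := exists_infinitePlace_factorisation L v
    (algebraMap v.Completion (AlgebraicClosure v.Completion)) φ (comp_embIntoClosure_comp_algebraMap L ι)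
  haveI : IsScalarTower K L w.Completion := isScalarTower_completion L w
  exact subgroupModelIso_mem_localKerOverOfEmb_of_factorisation L H' W p ι
    (NumberField.LiesOver.completionMap (v := v) (w := w)) ε hεf
    (fun l ↦ (RingHom.congr_fun hεφ l).trans (hφapply l)) (closure_range_completionMap_union_eq_top L v w) x
    (fun σ ↦ (((W.baseChange L).mem_selmerGroupOver_iff p H' x).1 hx).2 w σ)

/-- The same in the `conj_σ` form at the infinite places. [cite: GreenbergLNM1716, §2] -/
theorem conjH1_subgroupModelIso_mem_localKerOver_infinitePlace [(galImage K L H').Normal] (v : InfinitePlace K)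
    (σ : Field.absoluteGaloisGroup K)
    (x : (W.baseChange L).subgroupH1 p H') (hx : x ∈ (W.baseChange L).selmerGroupOver p H') :
    W.conjH1 p (galImage K L H') σ (subgroupModelIso K L H' W p x) ∈
      W.localKerOver p (galImage K L H') v.Completion := by
  have h := subgroupModelIso_mem_localKerOverOfEmb_infinitePlace L H' W p v
    ((closureEmb (K := K) v.Completion).comp
      ((show AlgebraicClosure K ≃ₐ[K] AlgebraicClosure K from σ) : AlgebraicClosure K →ₐ[K] AlgebraicClosure K)) x hx
  rw [W.localKerOverOfEmb_comp p (galImage K L H'), AddSubgroup.mem_comap] at h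
  rw [WeierstrassCurve.localKerOver_eq_ofEmb]
  exact h

end Infinite

/-! ## §4 `Θ(Sel^L_{H′}) ⊆ Sel^K_{galImage H′}` -/

section Selmer

variable [IsGalois K L] [(galImage K L H').Normal]

/-- **`subgroupModelIso` carries `Sel_{p^∞}(E_L/L̄^{H′})` into `Sel_{p^∞}(E/K̄^{galImage H′})`**: both are Selmer groups of
the same field `L̄^{H′} = K̄^{galImage H′}` — conditions at all places of `L` and all `Γ_L`-conjugates on the left, at all
places of `K` and all `Γ_K`-conjugates on the right; every local condition over `K` at a `K`-embedding `K̄ → K̄_v` is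
accounted for by a place of `L` above `v` (§2, §3). [cite: GreenbergLNM1716, §2] [cite: Mazur1972, §6] -/
theorem subgroupModelIso_mem_selmerGroupOver (x : (W.baseChange L).subgroupH1 p H')
    (hx : x ∈ (W.baseChange L).selmerGroupOver p H') :
    subgroupModelIso K L H' W p x ∈ W.selmerGroupOver p (galImage K L H') := by
  rw [WeierstrassCurve.mem_selmerGroupOver_iff]
  exact ⟨fun v σ ↦ conjH1_subgroupModelIso_mem_localKerOver_adicCompletion L H' W p v σ x hx,
    fun v σ ↦ conjH1_subgroupModelIso_mem_localKerOver_infinitePlace L H' W p v σ x hx⟩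

end Selmer

end Summit.BirchSwinnertonDyer.BirchSwinnertonDyer.Theorems.SelmerBaseChange

end
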